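import Summits.CriticalPhenomena.SAWScalingLimit.Theorems.SAWTotalPositivityCriticalBubbleBoundKestenHWSpanLength
import HarnessLib

/-!
# Line `kesten-product-renewal-dictionary` for the crux `SAWTotalPositivity.CriticalBubbleBound`
(stmt-CriticalPhenomena-7117): an effective bound on the critical mass of self-avoiding walks
confined to a strip (stub S8, word model)

In the step-word model of self-avoiding walks on `ℤ²` (`SAWWords.lean`, `SAWWordBridges.lean`:
`traj w i` is the position after `i` steps, `xAt w i = traj w i 0` the first coordinate) we prove
`stripWordMass_le`: IF for all `N, h` the critical mass `∑ x_c^{|u|}` of the self-avoiding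
half-space words `u` (`0 < x(i)` for `1 ≤ i ≤ |u|`, `Zd.IsHalfSpace`) of length `≤ N` and maximal
first coordinate `Zd.maxLevel ≤ h` is at most `2 ^ h` (the hypothesis; it is Kesten's bound, supplied
by the neighbouring stubs of the line), THEN for all `N, h` the critical mass of the self-avoiding
words of length `≤ N` confined to a vertical strip of width `h` (all first coordinates within `h`
of each other: `x(i) ≤ x(i') + h` for `i, i' ≤ |w|`) is at most `2 μ 4^h`
(`x_c = criticalFugacity = μ⁻¹`, `μ = connectiveConstant`): the strip susceptibility is finite at
the critical point, with an explicit bound.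

Proof (the cut at the last minimum, an elementary instance of the cut-and-reverse arguments of
Madras–Slade 1993, §3.1, cf. (3.1.7)): let `m` be the last time `≤ |w|` at which the first
coordinate of `w` is minimal (the last argmax `Zd.lastArgmax` of `-traj w`). The tail `w.drop m`
is a half-space word (after `m` the walk is strictly to the right of `x(m)`) of maximum `≤ h`
(the width). The head `w.take m`, with its letters reflected in the vertical axis (`0 ↔ 2`) and
read backwards, has first coordinates `x(m - j) - x(m) ∈ [0, h]` (minimality and width), so one
extra first step `+e₀` makes it a half-space word `z'` of length `m + 1 ≤ N + 1` and maximum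
`≤ h + 1` (`stripCut_cons_zero_spec`). The map `w ↦ (w.drop m, z')` is injective
(`w = reflect ((z'.tail).reverse) ++ w.drop m`) and `x_c^{|w|} = μ · x_c^{|w| - m} x_c^{m + 1}`
since `μ x_c = 1`; summing over the product of the two sets of half-space words gives the bound
`μ · 2^h · 2^{h+1} = 2 μ 4^h` (`stripCut_mass_le_of_split`).

## References

* N. Madras, G. Slade, *The Self-Avoiding Walk*, Birkhäuser (1993), §3.1 (half-space walks,
  Definition 3.1.2; cutting walks at extremal hyperplanes and reflecting, proof of Theorem 3.1.1
  and (3.1.7)), §4.2 (Kesten's renewal structure of bridges). The estimate itself is elementary.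
  [folklore]
-/

noncomputable section

open Literature.Probability.LatticeModels
open Literature.Probability.RandomPlanarGeometry Literature.Probability.RandomPlanarGeometry.SAW
open scoped ENNReal NNReal BigOperators
open Classical

namespace Summit.CriticalPhenomena.SAWScalingLimit.Theorems.CriticalBubbleBound.Kesten.HW

/-! ## The last minimum of the first coordinate -/

/-- **The last minimum.** Let `m` be the last argmax of `-traj w` on `[0, |w|]`, i.e. the last
time at which the first coordinate of `w` is minimal. Then `m ≤ |w|`, `x(m) ≤ x(i)` for all
`i ≤ |w|`, and `x(m) < x(i)` for `m < i ≤ |w|`.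
[cite: MadrasSlade1993, §3.1 (proof of Theorem 3.1.1)] -/
theorem stripCut_lastArgmin_spec (w : List Step) :
    Zd.lastArgmax w.length (-traj w) ≤ w.length ∧
      (∀ i ≤ w.length, xAt w (Zd.lastArgmax w.length (-traj w)) ≤ xAt w i) ∧
        (∀ i, Zd.lastArgmax w.length (-traj w) < i → i ≤ w.length →
          xAt w (Zd.lastArgmax w.length (-traj w)) < xAt w i) := by
  obtain ⟨hm, hM⟩ := Zd.lastArgmax_spec w.length (-traj w)
  refine ⟨hm, fun i hi => ?_, fun i h1 h2 => ?_⟩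
  · have h := Zd.apply_le_maxLevel (-traj w) hi
    rw [← hM] at h
    simp only [Pi.neg_apply, neg_le_neg_iff] at h
    exact h
  · have h := Zd.apply_lt_maxLevel_of_lastArgmax_lt (-traj w) h1 h2
    rw [← hM] at h
    simp only [Pi.neg_apply, neg_lt_neg_iff] at h
    exact h

/-! ## The tail: a half-space word of maximum at most the width -/

/-- **Tail of the cut at the last minimum.** If `w` is confined to a strip of width `h` and `m ≤ |w|`
is a time after which the first coordinate stays strictly above `x(m)`, then the suffix `w.drop m`
(first coordinates `x(m + i) - x(m)`) is a half-space word of maximum `≤ h`.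
[cite: MadrasSlade1993, §3.1] -/
theorem stripCut_drop_spec {w : List Step} {h : ℤ} {m : ℕ}
    (hw : ∀ i ≤ w.length, ∀ i' ≤ w.length, xAt w i ≤ xAt w i' + h) (hm : m ≤ w.length)
    (hlt : ∀ i, m < i → i ≤ w.length → xAt w m < xAt w i) :
    Zd.IsHalfSpace (w.drop m).length (traj (w.drop m)) ∧
      Zd.maxLevel (w.drop m).length (traj (w.drop m)) ≤ h := by
  have hlen : (w.drop m).length = w.length - m := List.length_drop
  refine ⟨fun i h1 h2 => ?_, Zd.maxLevel_le fun i hi => ?_⟩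
  · show xAt (w.drop m) 0 < xAt (w.drop m) i
    rw [xAt_zero, xAt_drop hm, sub_pos]
    rw [hlen] at h2
    exact hlt (m + i) (by omega) (by omega)
  · show xAt (w.drop m) i ≤ h
    rw [xAt_drop hm]
    rw [hlen] at hi
    have := hw (m + i) (by omega) m hm
    linarith

/-! ## The head, reflected and reversed -/

/-- First coordinates of a prefix: `x_{w.take k}(i) = x_w(i)` for `i ≤ k`. [folklore] -/
theorem stripCut_xAt_take (w : List Step) {i k : ℕ} (hik : i ≤ k) :
    xAt (w.take k) i = xAt w i := by
  rw [xAt, xAt, traj_take w hik]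

/-- First coordinates of the prefix `w.take m` (`m ≤ |w|`) reflected in the vertical axis (letter
map `r` negating `dx`, fixing `dy`) and read backwards: `x(j) = x_w(m - j) - x_w(m)`.
[folklore] -/
theorem stripCut_xAt_head (r : Step → Step) (hx : ∀ d, Step.dx (r d) = -Step.dx d)
    (hy : ∀ d, Step.dy (r d) = Step.dy d) {w : List Step} {m : ℕ} (hm : m ≤ w.length) (j : ℕ) :
    xAt ((w.take m).map r).reverse j = xAt w (m - j) - xAt w m := by
  have hlen : (w.take m).length = m := by rw [List.length_take, min_eq_left hm]
  rw [xAt_reverse, List.length_map, hlen, xAt_map_of_dx r hx hy, xEnd, List.length_map, hlen,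
    xAt_map_of_dx r hx hy, stripCut_xAt_take w le_rfl, stripCut_xAt_take w (Nat.sub_le m j)]
  ring

/-- For a word `w` confined to a strip of width `h` and a time `m ≤ |w|` at which the first
coordinate is minimal, the first coordinates of the reflected reversed prefix
`((w.take m).map r).reverse` lie in `[0, h]`. [cite: MadrasSlade1993, §3.1] -/
theorem stripCut_xAt_head_mem (r : Step → Step) (hx : ∀ d, Step.dx (r d) = -Step.dx d)
    (hy : ∀ d, Step.dy (r d) = Step.dy d) {w : List Step} {h : ℤ} {m : ℕ}
    (hw : ∀ i ≤ w.length, ∀ i' ≤ w.length, xAt w i ≤ xAt w i' + h) (hm : m ≤ w.length)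
    (hmin : ∀ i ≤ w.length, xAt w m ≤ xAt w i) (j : ℕ) :
    0 ≤ xAt ((w.take m).map r).reverse j ∧ xAt ((w.take m).map r).reverse j ≤ h := by
  rw [stripCut_xAt_head r hx hy hm]
  have h1 := hmin (m - j) (by omega)
  have h2 := hw (m - j) (by omega) m hm
  constructor <;> linarith

/-- **One more initial step.** If `z` is a self-avoiding word all of whose first coordinates lie in
`[0, L]`, then `0 :: z` is self-avoiding (the shifted positions have first coordinate `≥ 1`, so
none is the origin), is a half-space word, and has maximal first coordinate `≤ L + 1`.
[cite: MadrasSlade1993, §3.1] -/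
theorem stripCut_cons_zero_spec {z : List Step} (hs : IsSAW z) {L : ℤ}
    (hxz : ∀ j, 0 ≤ xAt z j ∧ xAt z j ≤ L) :
    IsSAW ((0 : Step) :: z) ∧
      Zd.IsHalfSpace ((0 : Step) :: z).length (traj ((0 : Step) :: z)) ∧
        Zd.maxLevel ((0 : Step) :: z).length (traj ((0 : Step) :: z)) ≤ L + 1 := by
  have hpos : ∀ j, 0 < xAt ((0 : Step) :: z) (j + 1) := fun j => by
    rw [xAt_cons_zero_succ]
    linarith [(hxz j).1]
  refine ⟨?_, fun i h1 _ => ?_, Zd.maxLevel_le fun i _ => ?_⟩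
  · rw [isSAW_iff_injOn] at hs ⊢
    rintro (_ | i) hi (_ | j) hj hij
    · rfl
    · exfalso
      have h0 : xAt ((0 : Step) :: z) 0 = xAt ((0 : Step) :: z) (j + 1) := congrFun hij 0
      rw [xAt_zero] at h0
      linarith [hpos j]
    · exfalso
      have h0 : xAt ((0 : Step) :: z) (i + 1) = xAt ((0 : Step) :: z) 0 := congrFun hij 0
      rw [xAt_zero] at h0
      linarith [hpos i]
    · simp only [Set.mem_setOf_eq, List.length_cons] at hi hj
      rw [traj_cons_succ, traj_cons_succ, add_right_inj] at hij
      rw [hs (show i ≤ z.length by omega) (show j ≤ z.length by omega) hij]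
  · obtain ⟨j, rfl⟩ : ∃ j, i = j + 1 := ⟨i - 1, by omega⟩
    show xAt _ 0 < xAt _ (j + 1)
    rw [xAt_zero]
    exact hpos j
  · rcases i with _ | j
    · show xAt _ 0 ≤ L + 1
      rw [xAt_zero]
      linarith [(hxz 0).1, (hxz 0).2]
    · show xAt _ (j + 1) ≤ L + 1
      rw [xAt_cons_zero_succ]
      linarith [(hxz j).2]

/-! ## The splitting at the last minimum -/

/-- **Cut at the last minimum (abstract form).** Let `r` be an involutive letter map negating `dx`
and fixing `dy` (the swap `0 ↔ 2`). Let `S` be a finite set of self-avoiding words of length `≤ N`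
confined to a strip of width `h`, and let `H₁ ⊇ {self-avoiding half-space words of maximum ≤ h and
length ≤ N}`, `H₂ ⊇ {self-avoiding half-space words of maximum ≤ h + 1 and length ≤ N + 1}` be
finite sets of critical masses `≤ b₁`, `≤ b₂`. Then `∑_{w ∈ S} x_c^{|w|} ≤ μ b₁ b₂`: with `m` the
last minimum of the first coordinate, `w` is sent injectively to
`(w.drop m, 0 :: ((w.take m).map r).reverse) ∈ H₁ × H₂`, and `x_c^{|w|} = μ x_c^{|w| - m} x_c^{m + 1}`.
[cite: MadrasSlade1993, §3.1 (proof of Theorem 3.1.1, (3.1.7))] -/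
theorem stripCut_mass_le_of_split (r : Step → Step) (hx : ∀ d, Step.dx (r d) = -Step.dx d)
    (hy : ∀ d, Step.dy (r d) = Step.dy d) (hr : ∀ d, r (r d) = d)
    {S H₁ H₂ : Finset (List Step)} {h : ℤ} {N : ℕ} {b₁ b₂ : ℝ}
    (hS : ∀ w ∈ S, IsSAW w ∧ (∀ i ≤ w.length, ∀ i' ≤ w.length, xAt w i ≤ xAt w i' + h) ∧
      w.length ≤ N)
    (hH₁ : ∀ u : List Step, IsSAW u → Zd.IsHalfSpace u.length (traj u) →
      Zd.maxLevel u.length (traj u) ≤ h → u.length ≤ N → u ∈ H₁)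
    (hH₂ : ∀ z : List Step, IsSAW z → Zd.IsHalfSpace z.length (traj z) →
      Zd.maxLevel z.length (traj z) ≤ h + 1 → z.length ≤ N + 1 → z ∈ H₂)
    (hb₁ : ∑ u ∈ H₁, criticalFugacity ^ u.length ≤ b₁)
    (hb₂ : ∑ z ∈ H₂, criticalFugacity ^ z.length ≤ b₂) :
    ∑ w ∈ S, criticalFugacity ^ w.length ≤ connectiveConstant * (b₁ * b₂) := by
  have hμ : 0 < connectiveConstant := by
    have h := Zd.connectiveConstant_pos 2
    rwa [Zd.connectiveConstant_two] at h
  have hx0 : 0 ≤ criticalFugacity := inv_nonneg.2 hμ.le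
  have hμx : connectiveConstant * criticalFugacity = 1 := mul_inv_cancel₀ hμ.ne'
  have hinjr : Function.Injective (List.map r) :=
    List.map_injective_iff.2 (Function.Involutive.injective hr)
  -- the cut at the last minimum `m`: `w ↦ (w.drop m, 0 :: ((w.take m).map r).reverse)`
  set cut : List Step → List Step × List Step := fun w =>
    (w.drop (Zd.lastArgmax w.length (-traj w)),
      (0 : Step) :: ((w.take (Zd.lastArgmax w.length (-traj w))).map r).reverse) with hcut
  -- the weight splits: `x_c^{|w|} = μ x_c^{|w| - m} x_c^{m + 1}`
  have e2 : ∀ w ∈ S, criticalFugacity ^ w.length = connectiveConstant *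
      (criticalFugacity ^ (cut w).1.length * criticalFugacity ^ (cut w).2.length) := by
    intro w _
    have hm := (stripCut_lastArgmin_spec w).1
    rw [hcut, ← pow_add, List.length_drop, List.length_cons, List.length_reverse, List.length_map,
      List.length_take, min_eq_left hm,
      show w.length - Zd.lastArgmax w.length (-traj w) + (Zd.lastArgmax w.length (-traj w) + 1) =
        w.length + 1 by omega, pow_succ, mul_left_comm, hμx, mul_one]
  -- the cut is injective: `w = w.take m ++ w.drop m` and `r` is an involution
  have hinj : Set.InjOn cut ↑S := by
    intro w _ w' _ he
    simp only [hcut, Prod.mk.injEq, List.cons.injEq, true_and, List.reverse_inj] at he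
    obtain ⟨hd, ht⟩ := he
    rw [← List.take_append_drop (Zd.lastArgmax w.length (-traj w)) w, hinjr ht, hd,
      List.take_append_drop]
  -- and lands in `H₁ × H₂`
  have hsub : S.image cut ⊆ H₁ ×ˢ H₂ := by
    intro q hq
    rw [Finset.mem_image] at hq
    obtain ⟨w, hw, rfl⟩ := hq
    obtain ⟨hs, hstrip, hl⟩ := hS w hw
    obtain ⟨hm, hmin, hlt⟩ := stripCut_lastArgmin_spec w
    obtain ⟨hv1, hv2⟩ := stripCut_drop_spec hstrip hm hlt
    obtain ⟨hz1, hz2, hz3⟩ := stripCut_cons_zero_spec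
      (isSAW_reverse (isSAW_map_of_dx r hx hy (hs.take (Zd.lastArgmax w.length (-traj w)))))
      (stripCut_xAt_head_mem r hx hy hstrip hm hmin)
    simp only [hcut, Finset.mem_product]
    refine ⟨hH₁ _ (hs.drop _) hv1 hv2 ?_, hH₂ _ hz1 hz2 hz3 ?_⟩
    · rw [List.length_drop]
      omega
    · rw [List.length_cons, List.length_reverse, List.length_map, List.length_take]
      omega
  calc ∑ w ∈ S, criticalFugacity ^ w.length
      = ∑ w ∈ S, connectiveConstant *
          (criticalFugacity ^ (cut w).1.length * criticalFugacity ^ (cut w).2.length) :=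
        Finset.sum_congr rfl e2
    _ = connectiveConstant * ∑ q ∈ S.image cut,
          criticalFugacity ^ q.1.length * criticalFugacity ^ q.2.length := by
        rw [Finset.sum_image hinj, Finset.mul_sum]
    _ ≤ connectiveConstant * ∑ q ∈ H₁ ×ˢ H₂,
          criticalFugacity ^ q.1.length * criticalFugacity ^ q.2.length :=
        mul_le_mul_of_nonneg_left (Finset.sum_le_sum_of_subset_of_nonneg hsub
          fun q _ _ => mul_nonneg (pow_nonneg hx0 _) (pow_nonneg hx0 _)) hμ.le
    _ = connectiveConstant * ((∑ u ∈ H₁, criticalFugacity ^ u.length) *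
          ∑ z ∈ H₂, criticalFugacity ^ z.length) := by
        rw [Finset.sum_product, Finset.sum_mul_sum]
    _ ≤ connectiveConstant * (b₁ * b₂) := by
        refine mul_le_mul_of_nonneg_left (mul_le_mul hb₁ hb₂ ?_ ?_) hμ.le
        · exact Finset.sum_nonneg fun z _ => pow_nonneg hx0 _
        · exact (Finset.sum_nonneg fun u _ => pow_nonneg hx0 _).trans hb₁

/-- **Stub S8: the critical strip mass is at most `2 μ 4^h` in the word model, given Kesten's
half-space bound.** If for all `N, h` the critical mass of the self-avoiding half-space words of
length `≤ N` and maximal first coordinate `≤ h` is at most `2 ^ h`, then for all `N, h` the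
critical mass `∑ x_c^{|w|}` of the self-avoiding words of length `≤ N` confined to a vertical
strip of width `h` (`x(i) ≤ x(i') + h` for all `i, i' ≤ |w|`) is at most `2 μ 4^h`
(`stripCut_mass_le_of_split` with the swap `0 ↔ 2`, `b₁ = 2^h`, `b₂ = 2^{h+1}`).
[cite: MadrasSlade1993, §3.1 (proof of Theorem 3.1.1, (3.1.7))] -/
theorem stripWordMass_le : (∀ N h : ℕ, (∑ w ∈ (Finset.range (N + 1)).biUnion (fun n => (sawWords n).filter (fun w => Zd.IsHalfSpace w.length (traj w) ∧ Zd.maxLevel w.length (traj w) ≤ (h : ℤ))), criticalFugacity ^ w.length) ≤ 2 ^ h) → ∀ N h : ℕ, (∑ w ∈ (Finset.range (N + 1)).biUnion (fun n => (sawWords n).filter (fun w => ∀ i ≤ w.length, ∀ i' ≤ w.length, xAt w i ≤ xAt w i' + (h : ℤ))), criticalFugacity ^ w.length) ≤ 2 * connectiveConstant * 4 ^ h := by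
  intro hyp N h
  -- the letter swap `0 ↔ 2` (reflection in the vertical axis) and its properties
  have hx : ∀ d : Step,
      Step.dx ((fun d : Step => if d = 0 then (2 : Step) else if d = 2 then 0 else d) d) =
        -Step.dx d := by
    decide
  have hy : ∀ d : Step,
      Step.dy ((fun d : Step => if d = 0 then (2 : Step) else if d = 2 then 0 else d) d) =
        Step.dy d := by
    decide
  have hinv : ∀ d : Step, (fun d : Step => if d = 0 then (2 : Step) else if d = 2 then 0 else d)
      ((fun d : Step => if d = 0 then (2 : Step) else if d = 2 then 0 else d) d) = d := by
    decide
  refine (stripCut_mass_le_of_split _ hx hy hinv (h := (h : ℤ)) (N := N) ?_ ?_ ?_ (hyp N h)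
    (hyp (N + 1) (h + 1))).trans (le_of_eq ?_)
  · intro w hw
    simp only [Finset.mem_biUnion, Finset.mem_range, Finset.mem_filter, mem_sawWords] at hw
    obtain ⟨n, hn, ⟨hl, hs⟩, hstrip⟩ := hw
    exact ⟨hs, hstrip, by omega⟩
  · intro u hs hh hm hl
    simp only [Finset.mem_biUnion, Finset.mem_range, Finset.mem_filter, mem_sawWords]
    exact ⟨u.length, by omega, ⟨rfl, hs⟩, hh, hm⟩
  · intro z hs hh hm hl
    simp only [Finset.mem_biUnion, Finset.mem_range, Finset.mem_filter, mem_sawWords]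
    refine ⟨z.length, by omega, ⟨rfl, hs⟩, hh, ?_⟩
    push_cast
    exact hm
  · rw [pow_succ, show (4 : ℝ) = 2 * 2 by norm_num, mul_pow]
    ring

end Summit.CriticalPhenomena.SAWScalingLimit.Theorems.CriticalBubbleBound.Kesten.HW

end
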